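/-
Copyright (c) 2026 the pub-hodgecm-mathlib formalisation cell (harness21).  Prover seat hodgecm-mathlib-R90-C131-p01 (g3), R90-TF section S6 «Ch. 14.1–14.5 stable trace
formula» (h413 = `stmt-HodgeConjecture-24833`), S6 dealer R90-C14-plan (g3) RULINGS #25 (R65) card (T4-VAL-a), FILE 1 of the census cut 2026-09-05T04:03:55Z: THE SPLIT
(APARTMENT) LAYER OF THE FIRST TWISTED SHELL at a type-(1) class.  THEOREMS ONLY (no `def`, no `instance`, no notation, no named-fact hypothesis, no `sorry`); ★-only imports,
NO `Lines` import, NO sheet import.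
-/
import Summits.HodgeConjecture.HodgeConjecture.Theorems.R90S6TwistedApartmentEigenFrame   -- ★ (T4.4) p865329: `inv_mul_mul_qsInvolution_eigenFrame_zpowDiagGL` (brings ★ TL4 (A.2), ★ L1 `mul_mul_mem_doubleCoset_iff`, `weylLong_mem_glInt`)
import Summits.HodgeConjecture.HodgeConjecture.Theorems.R90S6TwistedShellSymmetries        -- ★ (T4-SYM) p865338: `mk_out_twistedConj_mem_doubleCoset_iff` (the `q.out` test = the representative test, `σ` isometric)
import Literature.NumberTheory.Automorphic.HermitianLatticesLocal                          -- ★ `UnramifiedLocalConjDatum` (`vσ`, `σϖ`)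
import HarnessLib

/-!
# R90-TF · S6 «Ch. 14.1–14.5», (T4-VAL-a) FILE 1: THE SPLIT LAYER OF THE FIRST TWISTED SHELL `Shell(δ′, (1,0,0))` AT A TYPE-(1) CLASS — EXACTLY ONE APARTMENT VERTEX
# (Kottwitz 1986 §1 pp. 240–242, §3; Macdonald 1995 Ch. V §2 (2.2), (2.6))

Cell `hodgecm-mathlib`, crux H413 (`stmt-HodgeConjecture-24833`, lane `--supports … --as helper`), route of record `HCCMUnconditional` (no route verbs;
count-neutral).  Programme R90-TF, section S6, DAG row E1.4.4.2.2; S6 dealer R90-C14-plan (g3) (R65) «(T4-VAL-a) = (T4.7) + (T4.9), the two "ncard = 1" heads»; SPEC AUTHORITY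
typ2 (g3) (SHEET v2.3 0f48cf5c7bade6f2 §5 :294 (T4.7), D1-a memo 54c3d5da6c7c81b4).  This is FILE 1 of the three-file cut of the census (R90 bus 04:03:55Z): the SPLIT layer
(★-only inputs); FILE 2 = the (T4.7) head hypothesis-first on the non-split exclusion `hNS`; FILE 3 = the payer of `hNS` over (T4-NS) §4 + depth-0 rigidity.

THE MATHEMATICS.  Type-(1) frame letters of (T4.7): an eigenframe `g` of `δ′` (`g⁻¹δ′g = diag(d)`) with DIAGONAL Gram matrix `ᵗ(σg)·J₀·g = diag(u)`, and the class letter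
`v(d_i) = v(u_i·ϖ^{c_i})` (`c = ord d − ord u`; only `d∕u` matters — D1-a §6).  The apartment of the torus `T = g·D·g⁻¹` consists of the vertices `Λ_n = g·ϖ^n·𝒪^N`.
* §1 `mk_mul_zpowDiagGL_mem_twistedShell_iff`: **`[g·ϖ^n] ∈ Shell(δ′, a) ⟺ (c − 2n)` is a permutation of `a`** (any `a ∈ ℤ^N`; ★ (T4.4)'s explicit twisted position
  `diag(ϖ^{−n} d u⁻¹ ϖ^{−n})·w⁰`, `w⁰ ∈ K̃`, ★ TL4 (A.2); the shell's `q.out`-test equals the test at the representative `g·ϖ^n` because `σ` is isometric, ★ (T4-SYM)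
  `mk_out_twistedConj_mem_doubleCoset_iff`).
* §2 `existsUnique_ediv_perm_one_zero_zero` (pure parity arithmetic on `ℤ³`): if `Σ c_i` is odd and not all `c_i` are odd — i.e. EXACTLY ONE `c_i` is odd — then there is exactly
  ONE `n ∈ ℤ³` with `(c − 2n) ~ (1,0,0)`, namely `n_i = ⌊c_i ∕ 2⌋`.
* §3 **`existsUnique_apartment_mem_twistedShell_one_zero_zero`**: hence EXACTLY ONE apartment vertex `Λ_n` lies in the first shell `Shell(δ′, (1,0,0))` — the split layer of
  D1-a §2's count `V = 1` on the weight-one classes (the unique member of (T4.7) IS this vertex once FILE 3 excludes the non-split lattices); `ncard_apartment_mem_…_eq_one`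
  (the split-layer count) and `one_le_ncard_twistedShell_one_zero_zero` (`1 ≤ #Shell` for a finite shell, `Set.Finite` as a binder — dealer (R75)).
FRAME NOTE for typ2 (g3): the Cartan-uniqueness inputs (★ TL4 (A.2), `relPos`) need `[IsDiscreteValuationRing (ValuativeRel.valuation K).integer]`, which the sheet's §3∕§4
variable lines carry but §5∕§5b do not — it is added here as an instance binder (every place model discharges it; flag raised on the bus).
HONEST LABEL: HC_CM is proved only modulo the 7 printed citations (2 remaining named inputs: hLiu418 = stmt-HodgeConjecture-24832, h413 = stmt-HodgeConjecture-24833) until rung 0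
closes; split-layer count only (the non-split exclusion of (T4.7) is NOT proved here); count-neutral helper; REL ≠ ★ ≠ BUILT.

## References
* [Kottwitz1986BaseChangeUnits] R. E. Kottwitz, *Base change for unit elements of Hecke algebras*, Compositio Math. 60 (1986), §1 pp. 240–242, §3.
* [Macdonald1995] I. G. Macdonald, *Symmetric Functions and Hall Polynomials*, 2nd ed. (1995), Ch. V §2 (2.2), (2.6).
* [Rogawski1990] J. D. Rogawski, *Automorphic Representations of Unitary Groups in Three Variables*, Ann. of Math. Stud. 123 (1990), §4.10 pp. 57–58.
-/

set_option autoImplicit false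
-- the mandated namespace repeats the single-problem summit's segment (`HodgeConjecture.HodgeConjecture`)
set_option linter.dupNamespace false

noncomputable section

open scoped Valued WithZero Matrix MatrixGroups Pointwise
open Literature.NumberTheory.Automorphic Literature.NumberTheory.Automorphic.HermitianLattice Literature.NumberTheory.Automorphic.UnitaryLatticeTree

namespace Summit.HodgeConjecture.HodgeConjecture.R90.S6

/-! ## §1 Apartment vertices in a twisted shell -/

section Apartment

variable {K : Type} [Field K] [Valued K ℤᵐ⁰] [ValuativeRel K] [(Valued.v : Valuation K ℤᵐ⁰).Compatible] {σ : K →+* K} {N : ℕ}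
  [IsDiscreteValuationRing (ValuativeRel.valuation K).integer] {ϖ : K} (hϖ : IsUniformizingElement ϖ)

/-- **`[g·ϖ^n] ∈ Shell(δ′, a) ⟺ (c − 2n) ~ a`** for an orthogonal eigenframe `g` of `δ′` (`g⁻¹δ′g = diag(d)`, `ᵗ(σg)·J₀·g = diag(u)`) and the class letter `v(d_i) = v(u_i·ϖ^{c_i})`,
`σ` isometric with `σ ϖ = ϖ`, ANY `a ∈ ℤ^N`: the shell's `q.out`-test is the test at the representative (★ `mk_out_twistedConj_mem_doubleCoset_iff`), the twisted position of
`g·ϖ^n` is `diag(ϖ^{−n} d u⁻¹ ϖ^{−n})·w⁰` (★ `inv_mul_mul_qsInvolution_eigenFrame_zpowDiagGL`), `w⁰ ∈ K̃` drops (★ `mul_mul_mem_doubleCoset_iff`), and a diagonal element of valuation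
vector `c − 2n` lies in `K̃ϖ^aK̃` iff `c − 2n` is a permutation of `a` (★ TL4 (A.2)). [cite: Kottwitz1986BaseChangeUnits, §3] [cite: Macdonald1995, Ch. V §2 (2.2)] -/
theorem mk_mul_zpowDiagGL_mem_twistedShell_iff (hvσ : ∀ a, Valued.v (σ a) = Valued.v a) (hσϖ : σ ϖ = ϖ)
    {g δ' : GL (Fin N) K} {d u : Fin N → Kˣ} {c : Fin N → ℤ}
    (hδ : g⁻¹ * δ' * g = diagonalGL (Fin N) K d)
    (hu : formCongr σ g ((StdForm.antidiagonal N).over K) = Matrix.diagonal fun i => (u i : K))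
    (hc : ∀ i, Valued.v (d i : K) = Valued.v ((u i : K) * ϖ ^ c i)) (n a : Fin N → ℤ) :
    ((g * zpowDiagGL hϖ.ne_zero n : GL (Fin N) K) : GL (Fin N) K ⧸ glInt N K) ∈
        {x : GL (Fin N) K ⧸ glInt N K |
          x.out⁻¹ * δ' * UnitaryGroup.qsInvolution σ x.out ∈
            (glInt N K : Set (GL (Fin N) K)) * {zpowDiagGL hϖ.ne_zero a} * (glInt N K : Set (GL (Fin N) K))} ↔
      ∃ π : Equiv.Perm (Fin N), ∀ i, c (π i) - 2 * n (π i) = a i := by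
  have hv0 : Valued.v ϖ ≠ 0 := (Valuation.ne_zero_iff _).2 hϖ.ne_zero
  -- the valuation vector of the diagonal part of the twisted position is `c − 2n`
  have hw : ∀ i, Valued.v (((Units.mk0 ϖ hϖ.ne_zero ^ n i)⁻¹ * d i * (u i)⁻¹ * Units.mk0 ϖ hϖ.ne_zero ^ (-n i) : Kˣ) : K) =
      Valued.v (ϖ ^ (c i - 2 * n i)) := by
    intro i
    have hu0 : Valued.v (u i : K) ≠ 0 := (Valuation.ne_zero_iff _).2 (u i).ne_zero
    have hdu : Valued.v (d i : K) * (Valued.v (u i : K))⁻¹ = Valued.v ϖ ^ c i := by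
      rw [hc i, map_mul, map_zpow₀, mul_comm, ← mul_assoc, inv_mul_cancel₀ hu0, one_mul]
    rw [Units.val_mul, Units.val_mul, Units.val_mul, Units.val_inv_eq_inv_val, Units.val_inv_eq_inv_val, Units.val_zpow_eq_zpow_val,
      Units.val_zpow_eq_zpow_val, Units.val_mk0, map_mul, map_mul, map_mul, map_inv₀, map_inv₀, map_zpow₀, map_zpow₀, map_zpow₀,
      mul_assoc ((Valued.v ϖ ^ n i)⁻¹), hdu, ← zpow_neg, ← zpow_add₀ hv0, ← zpow_add₀ hv0]
    congr 1
    ring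
  rw [Set.mem_setOf_eq, mk_out_twistedConj_mem_doubleCoset_iff hvσ δ' (zpowDiagGL hϖ.ne_zero a) (g * zpowDiagGL hϖ.ne_zero n),
    mul_assoc (g * zpowDiagGL hϖ.ne_zero n)⁻¹, inv_mul_mul_qsInvolution_eigenFrame_zpowDiagGL hϖ hσϖ hδ hu n, ← one_mul (diagonalGL (Fin N) K _),
    mul_mul_mem_doubleCoset_iff (zpowDiagGL hϖ.ne_zero a) (glInt N K).one_mem (weylLong_mem_glInt N),
    diagonalGL_mem_doubleCoset_iff_exists_perm hϖ (e := fun i => c i - 2 * n i) hw a]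

end Apartment

/-! ## §2 Parity arithmetic on `ℤ³`: `(c − 2n) ~ (1,0,0)` has exactly one solution when exactly one `c_i` is odd -/

section Parity

/-- If `Σ c_i` is odd and not all three `c_i` are odd then EXACTLY ONE `c_i` is odd: there is `i₀` with `c_{i₀}` odd and `c_j` even for `j ≠ i₀`. [folklore] -/
theorem exists_unique_odd_of_odd_sum {c : Fin 3 → ℤ} (hodd : Odd (c 0 + c 1 + c 2)) (hone : ¬ (Odd (c 0) ∧ Odd (c 1) ∧ Odd (c 2))) :
    ∃ i₀ : Fin 3, Odd (c i₀) ∧ ∀ j, j ≠ i₀ → Even (c j) := by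
  have hs : (c 0 + c 1 + c 2) % 2 = 1 := Int.odd_iff.1 hodd
  have hne : ¬ (c 0 % 2 = 1 ∧ c 1 % 2 = 1 ∧ c 2 % 2 = 1) := fun h =>
    hone ⟨Int.odd_iff.2 h.1, Int.odd_iff.2 h.2.1, Int.odd_iff.2 h.2.2⟩
  by_cases h0 : c 0 % 2 = 1
  · have h1 : c 1 % 2 = 0 := by
      by_contra h1
      exact hne ⟨h0, by omega, by omega⟩
    refine ⟨0, Int.odd_iff.2 h0, fun j hj => Int.even_iff.2 ?_⟩
    fin_cases j
    · exact absurd rfl hj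
    · exact h1
    · show c 2 % 2 = 0
      omega
  · by_cases h1 : c 1 % 2 = 1
    · refine ⟨1, Int.odd_iff.2 h1, fun j hj => Int.even_iff.2 ?_⟩
      fin_cases j
      · show c 0 % 2 = 0
        omega
      · exact absurd rfl hj
      · show c 2 % 2 = 0
        omega
    · refine ⟨2, Int.odd_iff.2 (by omega), fun j hj => Int.even_iff.2 ?_⟩
      fin_cases j
      · show c 0 % 2 = 0
        omega
      · show c 1 % 2 = 0
        omega
      · exact absurd rfl hj

/-- **The solutions of `(c − 2n) ~ (1,0,0)`**: if exactly one `c_i` is odd (`Σ c_i` odd, not all odd) then `∃ π ∈ 𝔖₃, ∀ i, c (π i) − 2 n (π i) = (1,0,0)_i` holds for EXACTLY ONE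
`n ∈ ℤ³`, namely `n_i = ⌊c_i ∕ 2⌋` (the residues `c_i − 2n_i ∈ {0, 1}` are forced, and they are `c_i mod 2`). [folklore] -/
theorem existsUnique_ediv_perm_one_zero_zero {c : Fin 3 → ℤ} (hodd : Odd (c 0 + c 1 + c 2)) (hone : ¬ (Odd (c 0) ∧ Odd (c 1) ∧ Odd (c 2))) :
    ∃! n : Fin 3 → ℤ, ∃ π : Equiv.Perm (Fin 3), ∀ i, c (π i) - 2 * n (π i) = ![1, 0, 0] i := by
  obtain ⟨i₀, hi₀, hev⟩ := exists_unique_odd_of_odd_sum hodd hone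
  have hres₁ : c i₀ % 2 = 1 := Int.odd_iff.1 hi₀
  have hres₀ : ∀ j, j ≠ i₀ → c j % 2 = 0 := fun j hj => Int.even_iff.1 (hev j hj)
  refine ⟨fun i => c i / 2, ⟨Equiv.swap 0 i₀, fun i => ?_⟩, fun n hn => ?_⟩
  · -- existence: `π = (0 i₀)` puts the odd coordinate first
    have hdiv : ∀ j, c j - 2 * (c j / 2) = c j % 2 := fun j => by omega
    fin_cases i
    · show c (Equiv.swap 0 i₀ 0) - 2 * (c (Equiv.swap 0 i₀ 0) / 2) = 1
      rw [Equiv.swap_apply_left, hdiv, hres₁]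
    · show c (Equiv.swap (0 : Fin 3) i₀ 1) - 2 * (c (Equiv.swap (0 : Fin 3) i₀ 1) / 2) = 0
      have h1 : Equiv.swap (0 : Fin 3) i₀ 1 ≠ i₀ := fun h => by
        have h' := (Equiv.swap (0 : Fin 3) i₀).injective (h.trans (Equiv.swap_apply_left (0 : Fin 3) i₀).symm)
        exact absurd h' (by decide)
      rw [hdiv, hres₀ _ h1]
    · show c (Equiv.swap (0 : Fin 3) i₀ 2) - 2 * (c (Equiv.swap (0 : Fin 3) i₀ 2) / 2) = 0
      have h2 : Equiv.swap (0 : Fin 3) i₀ 2 ≠ i₀ := fun h => by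
        have h' := (Equiv.swap (0 : Fin 3) i₀).injective (h.trans (Equiv.swap_apply_left (0 : Fin 3) i₀).symm)
        exact absurd h' (by decide)
      rw [hdiv, hres₀ _ h2]
  · -- uniqueness: every coordinate residue `c_j − 2 n_j` is `0` or `1`, so `n_j = ⌊c_j ∕ 2⌋`
    obtain ⟨π, hπ⟩ := hn
    funext j
    have hj : c j - 2 * n j = 0 ∨ c j - 2 * n j = 1 := by
      have h := hπ (π.symm j)
      rw [Equiv.apply_symm_apply] at h
      rw [h]
      generalize π.symm j = i
      fin_cases i
      · exact Or.inr rfl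
      · exact Or.inl rfl
      · exact Or.inl rfl
    omega

end Parity

/-! ## §3 Exactly one apartment vertex in the first shell -/

section FirstShell

variable {K : Type} [Field K] [Valued K ℤᵐ⁰] [ValuativeRel K] [(Valued.v : Valuation K ℤᵐ⁰).Compatible] {σ : K →+* K}
  [IsDiscreteValuationRing (ValuativeRel.valuation K).integer] {ϖ : K} (hϖ : IsUniformizingElement ϖ)

/-- **EXACTLY ONE APARTMENT VERTEX OF `T = g·D·g⁻¹` LIES IN THE FIRST SHELL `Shell(δ′, (1,0,0))`** at a type-(1) class with exactly one odd `c_i` (`Σ c` odd, not all odd — the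
«weight-one» classes of D1-a §0): the vertex `Λ_n = g·ϖ^n·𝒪³` with `n_i = ⌊c_i ∕ 2⌋` and no other (§1 + §2).  This is the SPLIT layer of (T4.7)'s count `#Shell = 1`; that NO
non-split lattice enters is D1-a §1–§2 (FILE 3). [cite: Kottwitz1986BaseChangeUnits, §1 pp. 240–242, §3] [cite: Macdonald1995, Ch. V §2 (2.6)] -/
theorem existsUnique_apartment_mem_twistedShell_one_zero_zero (hd : UnramifiedLocalConjDatum σ ϖ)
    {g δ' : GL (Fin 3) K} {d u : Fin 3 → Kˣ} {c : Fin 3 → ℤ}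
    (hδ : g⁻¹ * δ' * g = diagonalGL (Fin 3) K d)
    (hu : formCongr σ g ((StdForm.antidiagonal 3).over K) = Matrix.diagonal fun i => (u i : K))
    (hc : ∀ i, Valued.v (d i : K) = Valued.v ((u i : K) * ϖ ^ c i))
    (hodd : Odd (c 0 + c 1 + c 2)) (hone : ¬ (Odd (c 0) ∧ Odd (c 1) ∧ Odd (c 2))) :
    ∃! n : Fin 3 → ℤ,
      ((g * zpowDiagGL hϖ.ne_zero n : GL (Fin 3) K) : GL (Fin 3) K ⧸ glInt 3 K) ∈
        {x : GL (Fin 3) K ⧸ glInt 3 K |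
          x.out⁻¹ * δ' * UnitaryGroup.qsInvolution σ x.out ∈
            (glInt 3 K : Set (GL (Fin 3) K)) * {zpowDiagGL hϖ.ne_zero ![1, 0, 0]} * (glInt 3 K : Set (GL (Fin 3) K))} := by
  obtain ⟨n₀, hn₀, huniq⟩ := existsUnique_ediv_perm_one_zero_zero hodd hone
  refine ⟨n₀, (mk_mul_zpowDiagGL_mem_twistedShell_iff hϖ hd.vσ hd.σϖ hδ hu hc n₀ ![1, 0, 0]).2 hn₀, fun n hn => ?_⟩
  exact huniq n ((mk_mul_zpowDiagGL_mem_twistedShell_iff hϖ hd.vσ hd.σϖ hδ hu hc n ![1, 0, 0]).1 hn)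

/-- **THE SPLIT-LAYER COUNT**: the set of apartment parameters `n ∈ ℤ³` whose vertex `g·ϖ^n·𝒪³` lies in `Shell(δ′, (1,0,0))` has exactly one element (`Set.ncard = 1`).
[cite: Kottwitz1986BaseChangeUnits, §3] -/
theorem ncard_apartment_mem_twistedShell_one_zero_zero_eq_one (hd : UnramifiedLocalConjDatum σ ϖ)
    {g δ' : GL (Fin 3) K} {d u : Fin 3 → Kˣ} {c : Fin 3 → ℤ}
    (hδ : g⁻¹ * δ' * g = diagonalGL (Fin 3) K d)
    (hu : formCongr σ g ((StdForm.antidiagonal 3).over K) = Matrix.diagonal fun i => (u i : K))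
    (hc : ∀ i, Valued.v (d i : K) = Valued.v ((u i : K) * ϖ ^ c i))
    (hodd : Odd (c 0 + c 1 + c 2)) (hone : ¬ (Odd (c 0) ∧ Odd (c 1) ∧ Odd (c 2))) :
    {n : Fin 3 → ℤ |
      ((g * zpowDiagGL hϖ.ne_zero n : GL (Fin 3) K) : GL (Fin 3) K ⧸ glInt 3 K) ∈
        {x : GL (Fin 3) K ⧸ glInt 3 K |
          x.out⁻¹ * δ' * UnitaryGroup.qsInvolution σ x.out ∈
            (glInt 3 K : Set (GL (Fin 3) K)) * {zpowDiagGL hϖ.ne_zero ![1, 0, 0]} * (glInt 3 K : Set (GL (Fin 3) K))}}.ncard = 1 := by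
  obtain ⟨n₀, hn₀, huniq⟩ := existsUnique_apartment_mem_twistedShell_one_zero_zero hϖ hd hδ hu hc hodd hone
  rw [Set.ncard_eq_one]
  exact ⟨n₀, Set.eq_singleton_iff_unique_mem.2 ⟨hn₀, huniq⟩⟩

/-- **`1 ≤ #Shell(δ′, (1,0,0))`** at a weight-one type-(1) class, for a FINITE shell (`Set.Finite` as a binder; at an elliptic base point it is ★ (T4.0c)
`twistedShell_finite_of_compactSpace_epsCentralizer`): the apartment vertex of §3 is a member. [cite: Kottwitz1986BaseChangeUnits, §3] -/
theorem one_le_ncard_twistedShell_one_zero_zero (hd : UnramifiedLocalConjDatum σ ϖ)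
    {g δ' : GL (Fin 3) K} {d u : Fin 3 → Kˣ} {c : Fin 3 → ℤ}
    (hδ : g⁻¹ * δ' * g = diagonalGL (Fin 3) K d)
    (hu : formCongr σ g ((StdForm.antidiagonal 3).over K) = Matrix.diagonal fun i => (u i : K))
    (hc : ∀ i, Valued.v (d i : K) = Valued.v ((u i : K) * ϖ ^ c i))
    (hodd : Odd (c 0 + c 1 + c 2)) (hone : ¬ (Odd (c 0) ∧ Odd (c 1) ∧ Odd (c 2)))
    (hfin : {x : GL (Fin 3) K ⧸ glInt 3 K |
      x.out⁻¹ * δ' * UnitaryGroup.qsInvolution σ x.out ∈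
        (glInt 3 K : Set (GL (Fin 3) K)) * {zpowDiagGL hϖ.ne_zero ![1, 0, 0]} * (glInt 3 K : Set (GL (Fin 3) K))}.Finite) :
    1 ≤ {x : GL (Fin 3) K ⧸ glInt 3 K |
      x.out⁻¹ * δ' * UnitaryGroup.qsInvolution σ x.out ∈
        (glInt 3 K : Set (GL (Fin 3) K)) * {zpowDiagGL hϖ.ne_zero ![1, 0, 0]} * (glInt 3 K : Set (GL (Fin 3) K))}.ncard := by
  obtain ⟨n₀, hn₀, -⟩ := existsUnique_apartment_mem_twistedShell_one_zero_zero hϖ hd hδ hu hc hodd hone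
  exact Nat.one_le_iff_ne_zero.2 ((Set.ncard_pos hfin).2 ⟨_, hn₀⟩).ne'

end FirstShell

end Summit.HodgeConjecture.HodgeConjecture.R90.S6

end
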